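import Mathlib.Data.Matrix.Block
import Mathlib.LinearAlgebra.Matrix.GeneralLinearGroup.Defs
import Mathlib.Tactic.Abel
import HarnessLib

/-!
# First-order reducibility of a block upper-triangular representation (stub `stub_firstOrderReducibility`) —
# line `sector-klingen-split`, crux `ResiduallyYoshidaLifting` (stmt-Langlands-13639)

Stub-worker of lead prover-line-stmt-Langlands-13639-c5-0 (cycle 2, 2026-08-17), skeleton rev 14, sub-goal TL (the TANGENT
LEVEL of the reducible locus at the block representation `ρ̄_B`).

Let `M g = (σ g, B g; 0, σ' g)` (`g : Γ`, `2 × 2` blocks over a field `k`) and let `N : Γ → M₄(k)` be a first-order deformation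
cochain of `M`, i.e. `M + εN` is a homomorphism over `k[ε]`: the derivation identity `N (g g') = M g · N g' + N g · M g'`.
Reading off the lower-left block of a product with a block upper-triangular matrix (`Matrix.fromBlocks_toBlocks`,
`Matrix.fromBlocks_multiply`, `Matrix.toBlocks_fromBlocks₂₁`) gives `(M g · N)₂₁ = σ' g · N₂₁` and `(N · M g)₂₁ = N₂₁ · σ g`, whence:

* (i) the lower-left block `c g = (N g)₂₁` is a `1`-cocycle for `Hom(σ, σ')`: `c (g g') = σ' g · c g' + c g · σ g'`;
* (ii) conjugating `M + εN` by `1 + εY` replaces `N` by `N + (Y M - M Y)`, whose lower-left block is `c + (Y₂₁ σ - σ' Y₂₁)`;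
* (iii) some conjugate has vanishing lower-left block iff `c g = σ' g · X - X · σ g` for one `X` (i.e. `[c] = 0` in
  `H¹(Γ, Hom(σ, σ'))`): `→` takes `X = Y₂₁` in (ii), `←` takes `Y = (0, 0; X, 0)`.

Pure Mathlib block-matrix algebra; no named facts.
-/

noncomputable section

set_option linter.dupNamespace false
set_option autoImplicit false

open scoped Matrix

namespace Summit.Langlands.Langlands.Cruxes.ResiduallyYoshidaLifting.SectorKlingenSplit.Fibre

/-- The lower-left block of a sum is the sum of the lower-left blocks. [folklore] -/
theorem toBlocks₂₁_add {R : Type*} [Add R] {m : Type*} (M M' : Matrix (m ⊕ m) (m ⊕ m) R) :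
    (M + M').toBlocks₂₁ = M.toBlocks₂₁ + M'.toBlocks₂₁ := by
  ext i j
  rfl

/-- The lower-left block of a difference is the difference of the lower-left blocks. [folklore] -/
theorem toBlocks₂₁_sub {R : Type*} [Sub R] {m : Type*} (M M' : Matrix (m ⊕ m) (m ⊕ m) R) :
    (M - M').toBlocks₂₁ = M.toBlocks₂₁ - M'.toBlocks₂₁ := by
  ext i j
  rfl

/-- Lower-left block of a LEFT multiple by a block upper-triangular matrix: `((A, B; 0, D) · N)₂₁ = D · N₂₁`. [folklore] -/
theorem toBlocks₂₁_fromBlocks_zero₂₁_mul {R : Type*} [NonUnitalNonAssocSemiring R] {m : Type*} [Fintype m]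
    (A B D : Matrix m m R) (N : Matrix (m ⊕ m) (m ⊕ m) R) :
    (Matrix.fromBlocks A B 0 D * N).toBlocks₂₁ = D * N.toBlocks₂₁ := by
  conv_lhs => rw [← Matrix.fromBlocks_toBlocks N, Matrix.fromBlocks_multiply]
  rw [Matrix.toBlocks_fromBlocks₂₁, Matrix.zero_mul, zero_add]

/-- Lower-left block of a RIGHT multiple by a block upper-triangular matrix: `(N · (A, B; 0, D))₂₁ = N₂₁ · A`. [folklore] -/
theorem toBlocks₂₁_mul_fromBlocks_zero₂₁ {R : Type*} [NonUnitalNonAssocSemiring R] {m : Type*} [Fintype m]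
    (N : Matrix (m ⊕ m) (m ⊕ m) R) (A B D : Matrix m m R) :
    (N * Matrix.fromBlocks A B 0 D).toBlocks₂₁ = N.toBlocks₂₁ * A := by
  conv_lhs => rw [← Matrix.fromBlocks_toBlocks N, Matrix.fromBlocks_multiply]
  rw [Matrix.toBlocks_fromBlocks₂₁, Matrix.mul_zero, add_zero]

/-- Lower-left block of the first-order coboundary change `N + (Y M - M Y)` for a block upper-triangular `M = (A, B; 0, D)`:
it is `N₂₁ + (Y₂₁ A - D Y₂₁)`. [folklore] -/
theorem toBlocks₂₁_add_conj_fromBlocks_zero₂₁ {R : Type*} [NonUnitalNonAssocRing R] {m : Type*} [Fintype m]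
    (N Y : Matrix (m ⊕ m) (m ⊕ m) R) (A B D : Matrix m m R) :
    (N + (Y * Matrix.fromBlocks A B 0 D - Matrix.fromBlocks A B 0 D * Y)).toBlocks₂₁ =
      N.toBlocks₂₁ + (Y.toBlocks₂₁ * A - D * Y.toBlocks₂₁) := by
  rw [toBlocks₂₁_add, toBlocks₂₁_sub, toBlocks₂₁_mul_fromBlocks_zero₂₁, toBlocks₂₁_fromBlocks_zero₂₁_mul]

/-- **Registered sub-goal TL `stub_firstOrderReducibility`** (skeleton rev 14 of line `sector-klingen-split`; the TANGENT LEVEL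
of the reducible locus at `ρ̄_B`): let `N : Γ → M₄(k)` be a first-order deformation cochain of the block representation
`M g = (σ̄ g, B g; 0, σ̄' g)` (`M + εN` is a homomorphism over `k[ε]`, i.e. the derivation identity
`N(gg') = M g · N g' + N g · M g'`).  Then (i) the lower-left block `c g = (N g)₂₁` is a 1-cocycle for `Hom(σ̄, σ̄')`
(`c(gg') = σ̄' g · c g' + c g · σ̄ g'`); (ii) conjugating by `1 + εY` replaces `N` by `N + (Y M - M Y)`, whose lower-left block
is `c + (Y₂₁ σ̄ - σ̄' Y₂₁)` — a coboundary change; (iii) the deformation is first-order REDUCIBLE in the adapted flag (some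
conjugate has vanishing lower-left block) iff `[c] = 0` in `H¹(Γ, Hom(σ̄, σ̄'))`. [folklore] -/
theorem stub_firstOrderReducibility :
    ∀ (k : Type) [Field k] (Γ : Type) [Group Γ] (σ σ' : Γ →* GL (Fin 2) k) (B : Γ → Matrix (Fin 2) (Fin 2) k)
      (N : Γ → Matrix (Fin 2 ⊕ Fin 2) (Fin 2 ⊕ Fin 2) k),
      (∀ g g', N (g * g') = Matrix.fromBlocks (σ g).val (B g) 0 (σ' g).val * N g' +
          N g * Matrix.fromBlocks (σ g').val (B g') 0 (σ' g').val) →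
      (∀ g g', (N (g * g')).toBlocks₂₁ = (σ' g).val * (N g').toBlocks₂₁ + (N g).toBlocks₂₁ * (σ g').val) ∧
      (∀ (Y : Matrix (Fin 2 ⊕ Fin 2) (Fin 2 ⊕ Fin 2) k) (g : Γ),
          (N g + (Y * Matrix.fromBlocks (σ g).val (B g) 0 (σ' g).val -
            Matrix.fromBlocks (σ g).val (B g) 0 (σ' g).val * Y)).toBlocks₂₁ =
            (N g).toBlocks₂₁ + (Y.toBlocks₂₁ * (σ g).val - (σ' g).val * Y.toBlocks₂₁)) ∧
      ((∃ Y : Matrix (Fin 2 ⊕ Fin 2) (Fin 2 ⊕ Fin 2) k, ∀ g,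
          (N g + (Y * Matrix.fromBlocks (σ g).val (B g) 0 (σ' g).val -
            Matrix.fromBlocks (σ g).val (B g) 0 (σ' g).val * Y)).toBlocks₂₁ = 0) ↔
        ∃ X : Matrix (Fin 2) (Fin 2) k, ∀ g, (N g).toBlocks₂₁ = (σ' g).val * X - X * (σ g).val) := by
  intro k _ Γ _ σ σ' B N hN
  -- (ii): the lower-left block of the coboundary change, for every `Y` and `g`
  have hconj : ∀ (Y : Matrix (Fin 2 ⊕ Fin 2) (Fin 2 ⊕ Fin 2) k) (g : Γ),
      (N g + (Y * Matrix.fromBlocks (σ g).val (B g) 0 (σ' g).val -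
        Matrix.fromBlocks (σ g).val (B g) 0 (σ' g).val * Y)).toBlocks₂₁ =
        (N g).toBlocks₂₁ + (Y.toBlocks₂₁ * (σ g).val - (σ' g).val * Y.toBlocks₂₁) := fun Y g =>
    toBlocks₂₁_add_conj_fromBlocks_zero₂₁ (N g) Y (σ g).val (B g) (σ' g).val
  refine ⟨fun g g' => ?_, hconj, ⟨?_, ?_⟩⟩
  · -- (i): the lower-left block of the derivation identity
    rw [hN g g', toBlocks₂₁_add, toBlocks₂₁_fromBlocks_zero₂₁_mul, toBlocks₂₁_mul_fromBlocks_zero₂₁]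
  · -- (iii) `→`: `0 = c g + (Y₂₁ σ - σ' Y₂₁)`, so `c g = σ' Y₂₁ - Y₂₁ σ`; take `X = Y₂₁`
    rintro ⟨Y, hY⟩
    refine ⟨Y.toBlocks₂₁, fun g => ?_⟩
    have h := hY g
    rw [hconj Y g, add_eq_zero_iff_eq_neg, neg_sub] at h
    exact h
  · -- (iii) `←`: take `Y = (0, 0; X, 0)`, whose lower-left block is `X`
    rintro ⟨X, hX⟩
    refine ⟨Matrix.fromBlocks 0 0 X 0, fun g => ?_⟩
    rw [hconj, Matrix.toBlocks_fromBlocks₂₁, hX g, sub_add_sub_cancel, sub_self]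

end Summit.Langlands.Langlands.Cruxes.ResiduallyYoshidaLifting.SectorKlingenSplit.Fibre

end
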